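import Summits.HodgeConjecture.HodgeCM.StubTree.Qw8Monomial_1

/-! PORT of `HodgeCM/StubTree/Qw8Monomial.lean` (HodgeCMPerL run 82) — part 2: continuation of `Summits.HodgeConjecture.HodgeCM.StubTree.Qw8Monomial_1` (split at a top-level declaration boundary by port_pkg.py; scope re-opened below; declarations unchanged). -/

-- port_pkg: scope re-opened for this part (file-level context, then the namespace/section stack open at the cut)
noncomputable section
open scoped TensorProduct NumberField Classical
namespace HodgeCM
open Literature.AlgebraicGeometry.Motives (CMType)
open HodgeCM.Pohlmann
namespace Universe
variable (U : Universe)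
variable {U}
section CM
variable {F : CMField} {n : ℕ} {Θ : Fin (n + 1) → CMType F}
  (x : (j : Fin (n + 1)) → ((F : Type) →+* ℂ) → U.CohC (U.cmAV F (Θ j)) 1)
/-- **Top monomials have nonzero trace**: an injective eigen-monomial of top degree `2 dim ∏_j A_{Θ_j}` has
`∫ ≠ 0` (`Fact_trTopCM`, with the degree count `Fact_dimProd` + M `Fact_cmAV`). -/
theorem trC_fmono_ne_zero (M : U.ModelAxioms) (hN1 : U.Fact_cupExterior) (ht : U.Fact_trTopCM)
    (hx : ∀ j τ, x j τ ∈ U.eigenLine F (Θ j) τ) (hsp : ∀ j, Submodule.span ℂ (Set.range (x j)) = ⊤) {K : ℕ}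
    {q : Fin (K + 1) → Fin (n + 1) × ((F : Type) →+* ℂ)} (hq : Function.Injective q)
    (h : K + 1 = 2 * U.dim (U.cmProd F Θ)) :
    U.trC (U.cmProd F Θ) (2 * U.dim (U.cmProd F Θ)) (U.castC _ h (U.fmono x K q)) ≠ 0 := by
  intro h0
  have h1 : U.castC _ h (U.fmono x K q) = 0 := by
    apply trC_top_injective ht
    rw [h0, map_zero]
  exact fmono_ne_zero x M hN1 hx hsp hq ((LinearEquiv.map_eq_zero_iff _).mp h1)

end CM

/-! ## 7. Weight vectors: products, pull-backs along block projections, dual partners -/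

/-- The zero class is a weight vector of every weight. -/
theorem isWeightVector_zero_vec (F : CMField) {n : ℕ} (Θ : Fin (n + 1) → CMType F)
    (S : Fin (n + 1) → Finset ((F : Type) →+* ℂ)) (k : ℕ) : U.IsWeightVector F Θ S k 0 :=
  fun _ _ _ _ => by rw [map_zero, smul_zero]

/-- Scalar multiples of weight vectors are weight vectors. -/
theorem isWeightVector_smul {F : CMField} {n : ℕ} {Θ : Fin (n + 1) → CMType F}
    {S : Fin (n + 1) → Finset ((F : Type) →+* ℂ)} {k : ℕ} {y : U.CohC (U.cmProd F Θ) k}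
    (hy : U.IsWeightVector F Θ S k y) (c : ℂ) : U.IsWeightVector F Θ S k (c • y) :=
  fun j a Ma hMa => by rw [map_smul, hy j a Ma hMa, smul_comm]

/-- **The cup product of weight vectors of DISJOINT weights is a weight vector of the union weight** (M3). -/
theorem isWeightVector_cupC_of_disjoint (hcup : U.Fact_pull_cup) {F : CMField} {n : ℕ}
    {Θ : Fin (n + 1) → CMType F} {S S' : Fin (n + 1) → Finset ((F : Type) →+* ℂ)}
    (hSS' : ∀ j, Disjoint (S j) (S' j)) {a b : ℕ} {y : U.CohC (U.cmProd F Θ) a} {y' : U.CohC (U.cmProd F Θ) b}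
    (hy : U.IsWeightVector F Θ S a y) (hy' : U.IsWeightVector F Θ S' b y') :
    U.IsWeightVector F Θ (fun j => S j ∪ S' j) (a + b) (U.cupC _ a b y y') := by
  intro j c Mo hMo
  rw [pullC_cupC U hcup, hy j c Mo hMo, hy' j c Mo hMo, Finset.prod_union (hSS' j)]
  simp only [map_smul, LinearMap.smul_apply, smul_smul, mul_comm]

section Block

variable {F : CMField} {n m : ℕ} (Ξ : Fin (n + 1 + (m + 1)) → CMType F)
  {pA : U.Mor (U.cmProd F Ξ) (U.cmProd F (blkA Ξ))} {pB : U.Mor (U.cmProd F Ξ) (U.cmProd F (blkB Ξ))}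

/-- `p_Y^* ∘ pr_j^* = pr_{castAdd j}^*` on `H¹ ⊗ ℂ` (the definition of a block pair, complexified). -/
theorem pullC_prC_blkA (hP : U.IsBlockPair F Ξ pA pB) (j : Fin (n + 1)) (y : U.CohC (U.cmAV F (blkA Ξ j)) 1) :
    U.pullC pA 1 (U.prC F (blkA Ξ) j y) = U.prC F Ξ (Fin.castAdd (m + 1) j) y := by
  have h := congrArg (LinearMap.baseChange ℂ) (hP.1 j 1)
  rw [LinearMap.baseChange_comp] at h
  exact LinearMap.congr_fun h y

/-- `p_{Y'}^* ∘ pr_i^* = pr_{natAdd i}^*` on `H¹ ⊗ ℂ`. -/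
theorem pullC_prC_blkB (hP : U.IsBlockPair F Ξ pA pB) (i : Fin (m + 1)) (y : U.CohC (U.cmAV F (blkB Ξ i)) 1) :
    U.pullC pB 1 (U.prC F (blkB Ξ) i y) = U.prC F Ξ (Fin.natAdd (n + 1) i) y := by
  have h := congrArg (LinearMap.baseChange ℂ) (hP.2 i 1)
  rw [LinearMap.baseChange_comp] at h
  exact LinearMap.congr_fun h y

variable (xP : (t : Fin (n + 1 + (m + 1))) → ((F : Type) →+* ℂ) → U.CohC (U.cmAV F (Ξ t)) 1)

/-- **Pull-back of an eigen-monomial of the first block = the lifted eigen-monomial of the product** (M3 + block pair). -/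
theorem pullC_fmono_blkA (hcup : U.Fact_pull_cup) (hP : U.IsBlockPair F Ξ pA pB) (k : ℕ)
    (p : Fin (k + 1) → Fin (n + 1) × ((F : Type) →+* ℂ)) :
    U.pullC pA (k + 1) (U.fmono (Θ := blkA Ξ) (fun j => xP (Fin.castAdd (m + 1) j)) k p) =
      U.fmono xP k (fun i => (Fin.castAdd (m + 1) (p i).1, (p i).2)) := by
  rw [fmono_eq, fmono_eq, pullC_cupPowC hcup]
  congr 1
  funext i
  exact U.pullC_prC_blkA Ξ hP (p i).1 (xP _ (p i).2)

/-- (Ported verbatim from the HodgeCMPerL package; no docstring in the source.) -/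
theorem pullC_fmono_blkB (hcup : U.Fact_pull_cup) (hP : U.IsBlockPair F Ξ pA pB) (k : ℕ)
    (p : Fin (k + 1) → Fin (m + 1) × ((F : Type) →+* ℂ)) :
    U.pullC pB (k + 1) (U.fmono (Θ := blkB Ξ) (fun i => xP (Fin.natAdd (n + 1) i)) k p) =
      U.fmono xP k (fun i => (Fin.natAdd (n + 1) (p i).1, (p i).2)) := by
  rw [fmono_eq, fmono_eq, pullC_cupPowC hcup]
  congr 1
  funext i
  exact U.pullC_prC_blkB Ξ hP (p i).1 (xP _ (p i).2)

/-- **Pull-backs of weight vectors along the first block projection are weight vectors** of weight `(S, ∅)` —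
positive degree; a THEOREM of `ModelAxioms` + N1 (monomial calculus), replacing F2 `Fact_factorActDescends`. -/
theorem isWeightVector_pullC_blkA (M : U.ModelAxioms) (hN1 : U.Fact_cupExterior) (hP : U.IsBlockPair F Ξ pA pB)
    {a : ℕ} (ha : 0 < a) {S : Fin (n + 1) → Finset ((F : Type) →+* ℂ)} {y : U.CohC (U.cmProd F (blkA Ξ)) a}
    (hy : U.IsWeightVector F (blkA Ξ) S a y) :
    U.IsWeightVector F Ξ (Fin.append S (fun _ : Fin (m + 1) => (∅ : Finset ((F : Type) →+* ℂ))) :) a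
      (U.pullC pA a y) := by
  obtain ⟨k, rfl⟩ := Nat.exists_eq_add_one_of_ne_zero ha.ne'
  by_cases hy0 : y = 0
  · rw [hy0, map_zero]; exact U.isWeightVector_zero_vec F Ξ _ _
  obtain ⟨β, -, hβ⟩ := exists_integral_injective_eval F
  choose xP hxP _hx0 hsp using fun t => exists_eigenbasis M F (Ξ t) β hβ
  obtain ⟨p, hp, rfl, c, rfl⟩ := exists_eq_smul_fmono (Θ := blkA Ξ) (fun j => xP (Fin.castAdd (m + 1) j)) M hN1
    (fun j τ => hxP _ τ) (fun j => hsp _) hy hy0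
  rw [map_smul, U.pullC_fmono_blkA Ξ xP M.pull_cup hP, ← wtOf_liftA]
  refine isWeightVector_smul (isWeightVector_fmono xP M hxP k _ ?_) c
  intro i i' h
  simp only [Prod.mk.injEq, Fin.castAdd_inj] at h
  exact hp (Prod.ext h.1 h.2)

/-- The same along the second block projection: weight `(∅, S')`. -/
theorem isWeightVector_pullC_blkB (M : U.ModelAxioms) (hN1 : U.Fact_cupExterior) (hP : U.IsBlockPair F Ξ pA pB)
    {b : ℕ} (hb : 0 < b) {S' : Fin (m + 1) → Finset ((F : Type) →+* ℂ)} {y : U.CohC (U.cmProd F (blkB Ξ)) b}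
    (hy : U.IsWeightVector F (blkB Ξ) S' b y) :
    U.IsWeightVector F Ξ (Fin.append (fun _ : Fin (n + 1) => (∅ : Finset ((F : Type) →+* ℂ))) S' :) b
      (U.pullC pB b y) := by
  obtain ⟨k, rfl⟩ := Nat.exists_eq_add_one_of_ne_zero hb.ne'
  by_cases hy0 : y = 0
  · rw [hy0, map_zero]; exact U.isWeightVector_zero_vec F Ξ _ _
  obtain ⟨β, -, hβ⟩ := exists_integral_injective_eval F
  choose xP hxP _hx0 hsp using fun t => exists_eigenbasis M F (Ξ t) β hβ
  obtain ⟨p, hp, rfl, c, rfl⟩ := exists_eq_smul_fmono (Θ := blkB Ξ) (fun i => xP (Fin.natAdd (n + 1) i)) M hN1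
    (fun i τ => hxP _ τ) (fun i => hsp _) hy hy0
  rw [map_smul, U.pullC_fmono_blkB Ξ xP M.pull_cup hP, ← wtOf_liftB]
  refine isWeightVector_smul (isWeightVector_fmono xP M hxP k _ ?_) c
  intro i i' h
  simp only [Prod.mk.injEq] at h
  exact hp (Prod.ext (Fin.natAdd_inj _ |>.mp h.1) h.2)

/-- **The exterior product of weight vectors is a weight vector of the concatenated weight** — positive degrees;
a THEOREM of `ModelAxioms` + N1, replacing `isWeightVector_box` (which used F2). -/
theorem isWeightVector_box' (M : U.ModelAxioms) (hN1 : U.Fact_cupExterior) (hP : U.IsBlockPair F Ξ pA pB)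
    {a b : ℕ} (ha : 0 < a) (hb : 0 < b)
    {S : Fin (n + 1) → Finset ((F : Type) →+* ℂ)} {S' : Fin (m + 1) → Finset ((F : Type) →+* ℂ)}
    {y : U.CohC (U.cmProd F (blkA Ξ)) a} {y' : U.CohC (U.cmProd F (blkB Ξ)) b}
    (hy : U.IsWeightVector F (blkA Ξ) S a y) (hy' : U.IsWeightVector F (blkB Ξ) S' b y') :
    U.IsWeightVector F Ξ (Fin.append S S' :) (a + b)
      (U.cupC (U.cmProd F Ξ) a b (U.pullC pA a y) (U.pullC pB b y')) := by
  have h := U.isWeightVector_cupC_of_disjoint M.pull_cup (S := (Fin.append S (fun _ : Fin (m + 1) => ∅) :))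
    (S' := (Fin.append (fun _ : Fin (n + 1) => ∅) S' :)) (fun t => ?_)
    (U.isWeightVector_pullC_blkA Ξ M hN1 hP ha hy) (U.isWeightVector_pullC_blkB Ξ M hN1 hP hb hy')
  · convert h using 2 with t
    refine Fin.addCases (m := n + 1) (n := m + 1) (fun j => ?_) (fun i => ?_) t <;> simp
  · refine Fin.addCases (m := n + 1) (n := m + 1) (fun j => ?_) (fun i => ?_) t <;> simp

end Block


/-! ## 8. The Poincaré-dual partner of a weight vector: F6 `Fact_weightDual` as a THEOREM (non-full weights) -/

section Partner

variable {F : CMField} {m : ℕ} (Θ' : Fin (m + 1) → CMType F)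

/-- Core, in monomial degrees: a nonzero weight vector `y` of weight `S' ≠ (univ)_i` in degree `l + 1` is
`c · fmono p` (`c ≠ 0`); its partner is the COMPLEMENTARY eigen-monomial `fmono p'`, of weight `S'ᶜ`, and
`fmono p' ∪ y = c · fmono (append p' p)`, `y ∪ fmono p' = c · fmono (append p p')` are nonzero multiples of top
monomials, so have nonzero trace (`Fact_trTopCM`). -/
theorem exists_partner_mono (M : U.ModelAxioms) (hN1 : U.Fact_cupExterior) (h5 : U.Fact_cupAssoc)
    (hd : U.Fact_dimProd) (ht : U.Fact_trTopCM) {l : ℕ} {S' : Fin (m + 1) → Finset ((F : Type) →+* ℂ)}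
    {y : U.CohC (U.cmProd F Θ') (l + 1)} (hy : U.IsWeightVector F Θ' S' (l + 1) y) (hy0 : y ≠ 0)
    (hS' : S' ≠ fun _ => Finset.univ) :
    ∃ (l' : ℕ) (y' : U.CohC (U.cmProd F Θ') (l' + 1)), l' + 1 + (l + 1) = 2 * U.dim (U.cmProd F Θ') ∧
      U.IsWeightVector F Θ' (fun i => (S' i)ᶜ) (l' + 1) y' ∧
      U.trC _ _ (U.cupC (U.cmProd F Θ') (l' + 1) (l + 1) y' y) ≠ 0 ∧
      U.trC _ _ (U.cupC (U.cmProd F Θ') (l + 1) (l' + 1) y y') ≠ 0 := by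
  obtain ⟨β, -, hβ⟩ := exists_integral_injective_eval F
  choose xB hxB _hx0 hsp using fun i => exists_eigenbasis M F (Θ' i) β hβ
  obtain ⟨p, hp, hwt, c, rfl⟩ := U.exists_eq_smul_fmono xB M hN1 hxB hsp hy hy0
  have hc : c ≠ 0 := by rintro rfl; exact hy0 (zero_smul _ _)
  have hns : ¬Function.Surjective p := fun hs => hS' (hwt.symm.trans (wtOf_eq_univ_of_surjective hs))
  obtain ⟨l', p', hp', h1, h2, hcard⟩ := exists_compl_enum p hp hns
  have hdeg : l' + 1 + (l + 1) = 2 * U.dim (U.cmProd F Θ') := by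
    rw [hcard, card_index, two_mul_dim_cmProd_of_dimProd M hd]
  have hdeg2 : l + 1 + (l' + 1) = 2 * U.dim (U.cmProd F Θ') := by omega
  have hwt' : wtOf l' p' = fun i => (S' i)ᶜ := by rw [wtOf_eq_compl h1 h2, hwt]
  have hinj1 : Function.Injective (Fin.append p' p : Fin (l' + 1 + (l + 1)) → _) :=
    Fin.append_injective_iff.mpr ⟨hp', hp, fun i j h => h1 i ⟨j, h.symm⟩⟩
  have hinj2 : Function.Injective (Fin.append p p' : Fin (l + 1 + (l' + 1)) → _) :=
    Fin.append_injective_iff.mpr ⟨hp, hp', fun i j h => h1 j ⟨i, h⟩⟩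
  refine ⟨l', U.fmono xB l' p', hdeg, ?_, ?_, ?_⟩
  · rw [← hwt']; exact isWeightVector_fmono xB M hxB l' p' hp'
  · rw [map_smul, U.cupC_fmono_fmono xB h5, ← U.trC_castC _ hdeg, map_smul, map_smul, smul_eq_mul]
    exact mul_ne_zero hc (U.trC_fmono_ne_zero xB M hN1 ht hxB hsp hinj1 hdeg)
  · rw [map_smul, LinearMap.smul_apply, U.cupC_fmono_fmono xB h5, ← U.trC_castC _ hdeg2, map_smul, map_smul,
      smul_eq_mul]
    exact mul_ne_zero hc (U.trC_fmono_ne_zero xB M hN1 ht hxB hsp hinj2 hdeg2)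

/-- **F6 `Fact_weightDual` for weight vectors of positive degree and non-full weight is a THEOREM** of
`ModelAxioms`, N1 `Fact_cupExterior`, F5 `Fact_cupAssoc` and the two generic facts `Fact_dimProd`, `Fact_trTopCM`
(same conclusion as `Fact_weightDual`, verbatim but for the sharper `q < dim`: a non-full weight is not top). -/
theorem weightDual_of_facts (M : U.ModelAxioms) (hN1 : U.Fact_cupExterior) (h5 : U.Fact_cupAssoc)
    (hd : U.Fact_dimProd) (ht : U.Fact_trTopCM) (q : ℕ) (S' : Fin (m + 1) → Finset ((F : Type) →+* ℂ))
    (w : U.CohC (U.cmProd F Θ') (2 * q)) (hw0 : w ≠ 0) (hw : U.IsWeightVector F Θ' S' (2 * q) w) (hq : 0 < q)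
    (hS' : S' ≠ fun _ => Finset.univ) :
    q < U.dim (U.cmProd F Θ') ∧
    ∃ w' : U.CohC (U.cmProd F Θ') (2 * (U.dim (U.cmProd F Θ') - q)),
      U.IsWeightVector F Θ' (fun i => (S' i)ᶜ) (2 * (U.dim (U.cmProd F Θ') - q)) w' ∧
      U.trC (U.cmProd F Θ') _ (U.cupC (U.cmProd F Θ') _ _ w' w) ≠ 0 ∧
      U.trC (U.cmProd F Θ') _ (U.cupC (U.cmProd F Θ') _ _ w w') ≠ 0 := by
  obtain ⟨l, hl⟩ : ∃ l, 2 * q = l + 1 := ⟨2 * q - 1, by omega⟩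
  obtain ⟨l', y', hdeg, hw', htr1, htr2⟩ := U.exists_partner_mono Θ' M hN1 h5 hd ht
    (U.isWeightVector_castC F Θ' S' hl hw) (fun h => hw0 ((LinearEquiv.map_eq_zero_iff _).mp h)) hS'
  have h1 : l' + 1 = 2 * (U.dim (U.cmProd F Θ') - q) := by omega
  have e : w = U.castC _ hl.symm (U.castC _ hl w) := by rw [castC_castC, castC_self]
  refine ⟨by omega, U.castC _ h1 y', U.isWeightVector_castC F Θ' _ h1 hw', ?_, ?_⟩
  · rw [e, cupC_castC_left, cupC_castC_right, castC_castC, trC_castC]; exact htr1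
  · rw [e, cupC_castC_left, cupC_castC_right, castC_castC, trC_castC]; exact htr2

end Partner

/-! ## 9. [QW8] Thm 2.5 steps (ii) and (iii)+(v) in POSITIVE degree, from the generic facts -/

variable (U) in
/-- Step (ii) `Qw8ExtProd` restricted to weight vectors of positive degree (the output has positive degree). -/
def Qw8ExtProdPos : Prop :=
  ∀ (F : CMField), IsGalois ℚ F → 6 ≤ Module.finrank ℚ F → ∀ (v w : U.WVec F), v.IsAlg → w.IsAlg →
    0 < v.p → 0 < w.p → ∃ z : U.WVec F, z.IsAlg ∧ 0 < z.p ∧ z.achar = v.achar + w.achar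

variable (U) in
/-- Steps (iii)+(v) `Qw8DualPushPull` restricted to `e`, `W` of positive degree. -/
def Qw8DualPushPullPos : Prop :=
  ∀ (F : CMField), IsGalois ℚ F → 6 ≤ Module.finrank ℚ F → ∀ (e W : U.WVec F), 0 < e.p → 0 < W.p →
    W.IsAlg → ∃ Z : U.WVec F, Z.achar = e.achar - W.achar ∧ (Z.IsAlg → e.IsAlg)

/-- **Step (ii) in positive degree from `ModelAxioms`, N1, F4, F5, F7, `Fact_dimProd`, `Fact_trTopCM`** — the proof
of `qw8ExtProd_of_facts` with F6 replaced by `weightDual_of_facts` and F2 by `isWeightVector_box'`; a `w` of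
full weight `(univ)_i` has `a(w) = 0` (`lefChar_univ_eq_zero`) and then `z := v`. -/
theorem qw8ExtProdPos_of_facts (M : U.ModelAxioms) (hN1 : U.Fact_cupExterior) (h4 : U.Fact_cupAlg)
    (h5 : U.Fact_cupAssoc) (h7 : U.Fact_gysin) (hd : U.Fact_dimProd) (ht : U.Fact_trTopCM) : U.Qw8ExtProdPos := by
  intro F _ _ v w hv hw hvp hwp
  by_cases hSw : w.S = fun _ => Finset.univ
  · refine ⟨v, hv, hvp, ?_⟩
    rw [show w.achar = lefChar w.Θ w.S from rfl, hSw, lefChar_univ_eq_zero, add_zero]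
  obtain ⟨n, Θ, p, S, x, hx0, hxw⟩ := v
  obtain ⟨m, Θ', q, S', y, hy0, hyw⟩ := w
  change x ∈ U.algC (U.cmProd F Θ) p at hv
  change y ∈ U.algC (U.cmProd F Θ') q at hw
  change 0 < p at hvp
  change 0 < q at hwp
  change ¬(S' = fun _ => Finset.univ) at hSw
  let Ξ : Fin (n + 1 + (m + 1)) → CMType F := Fin.append Θ Θ'
  have hA : blkA Ξ = Θ := blkA_append Θ Θ'
  have hB : blkB Ξ = Θ' := blkB_append Θ Θ'
  obtain ⟨x₂, h0x, hwx, hax⟩ := U.transport_wvec hA.symm p S x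
  obtain ⟨y₂, h0y, hwy, hay⟩ := U.transport_wvec hB.symm q S' y
  obtain ⟨pA, pB, hP⟩ := U.blockPair_exists M.pull_id M.pull_comp M.lift F n m Ξ
  have hdeg : 2 * p + 2 * q = 2 * (p + q) := by omega
  obtain ⟨hq, y', -, -, htr2⟩ := U.weightDual_of_facts (blkB Ξ) M hN1 h5 hd ht q S' y₂
    (fun h => hy0 (h0y.mpr h)) (hwy.mp hyw) hwp hSw
  have hij : 2 * q + 2 * (U.dim (U.cmProd F (blkB Ξ)) - q) = 2 * U.dim (U.cmProd F (blkB Ξ)) := by omega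
  have hz0 : U.cupC (U.cmProd F Ξ) (2 * p) (2 * q) (U.pullC pA (2 * p) x₂) (U.pullC pB (2 * q) y₂) ≠ 0 :=
    U.box_ne_zero M h5 h7 Ξ hP (fun h => hx0 (h0x.mpr h)) y₂ y' hij (by rw [trC_castC]; exact htr2)
  have hzw := U.isWeightVector_box' Ξ M hN1 hP (by omega) (by omega) (hwx.mp hxw) (hwy.mp hyw)
  refine ⟨⟨n + 1 + m, Ξ, p + q, (Fin.append S S' :), U.castC _ hdeg
      (U.cupC (U.cmProd F Ξ) (2 * p) (2 * q) (U.pullC pA (2 * p) x₂) (U.pullC pB (2 * q) y₂)),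
      fun h => hz0 ((LinearEquiv.map_eq_zero_iff _).mp h), U.isWeightVector_castC F Ξ _ hdeg hzw⟩, ?_, ?_, ?_⟩
  · exact U.cupC_mem_algC h4 _ p q (U.pullC_mem_algC M.pull_alg pA p (hax.mp hv))
      (U.pullC_mem_algC M.pull_alg pB q (hay.mp hw)) hdeg
  · change 0 < p + q
    omega
  · show lefChar Ξ (Fin.append S S' :) = lefChar Θ S + lefChar Θ' S'
    rw [lefChar_append, lefChar_congr hA, lefChar_congr hB]

/-- **Steps (iii)+(v) in positive degree from `ModelAxioms`, N1, F4, F5, F7, `Fact_dimProd`, `Fact_trTopCM`** — the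
proof of `qw8DualPushPull_of_facts` with F6 replaced by `weightDual_of_facts` and F2 by `isWeightVector_box'`; a
`W` of full weight has `a(W) = 0` and then `Z := e`. -/
theorem qw8DualPushPullPos_of_facts (M : U.ModelAxioms) (hN1 : U.Fact_cupExterior) (h4 : U.Fact_cupAlg)
    (h5 : U.Fact_cupAssoc) (h7 : U.Fact_gysin) (hd : U.Fact_dimProd) (ht : U.Fact_trTopCM) :
    U.Qw8DualPushPullPos := by
  intro F _ _ e W hep hWp hW
  by_cases hSW : W.S = fun _ => Finset.univ
  · refine ⟨e, ?_, id⟩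
    rw [show W.achar = lefChar W.Θ W.S from rfl, hSW, lefChar_univ_eq_zero, sub_zero]
  obtain ⟨n, Θ, p, S, x, hx0, hxw⟩ := e
  obtain ⟨m, Θ', q, S', w, hw0, hww⟩ := W
  change w ∈ U.algC (U.cmProd F Θ') q at hW
  change 0 < p at hep
  change 0 < q at hWp
  change ¬(S' = fun _ => Finset.univ) at hSW
  let Ξ : Fin (n + 1 + (m + 1)) → CMType F := Fin.append Θ Θ'
  have hA : blkA Ξ = Θ := blkA_append Θ Θ'
  have hB : blkB Ξ = Θ' := blkB_append Θ Θ'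
  obtain ⟨x₂, h0x, hwx, hax⟩ := U.transport_wvec hA.symm p S x
  obtain ⟨w₂, h0w, hww₂, haw⟩ := U.transport_wvec hB.symm q S' w
  obtain ⟨pA, pB, hP⟩ := U.blockPair_exists M.pull_id M.pull_comp M.lift F n m Ξ
  -- (iii) the dual partner `w'` of `W` on the second block — now CONSTRUCTED (complementary monomial)
  obtain ⟨hq, w₁, hw₁, htr₁, -⟩ := U.weightDual_of_facts (blkB Ξ) M hN1 h5 hd ht q S' w₂
    (fun h => hw0 (h0w.mpr h)) (hww₂.mp hww) hWp hSW
  -- normalise: `w' := (∫ w₁ ∪ W)⁻¹ • w₁`, so that `∫ w' ∪ W = 1`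
  obtain ⟨w', hw', htr⟩ : ∃ w' : U.CohC (U.cmProd F (blkB Ξ)) (2 * (U.dim (U.cmProd F (blkB Ξ)) - q)),
      U.IsWeightVector F (blkB Ξ) (fun i => (S' i)ᶜ) (2 * (U.dim (U.cmProd F (blkB Ξ)) - q)) w' ∧
      U.trC (U.cmProd F (blkB Ξ)) _ (U.cupC (U.cmProd F (blkB Ξ)) _ _ w' w₂) = 1 := by
    refine ⟨(U.trC (U.cmProd F (blkB Ξ)) _ (U.cupC (U.cmProd F (blkB Ξ)) _ _ w₁ w₂))⁻¹ • w₁, ?_, ?_⟩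
    · intro j a N hN
      rw [map_smul, hw₁ j a N hN, smul_comm]
    · rw [map_smul, LinearMap.smul_apply, map_smul, smul_eq_mul, inv_mul_cancel₀ htr₁]
  have h6' : 2 * (U.dim (U.cmProd F (blkB Ξ)) - q) + 2 * q = 2 * U.dim (U.cmProd F (blkB Ξ)) := by omega
  -- `Z := p_Y^* e ∪ p_{Y'}^* w'`
  have hdeg : 2 * p + 2 * (U.dim (U.cmProd F (blkB Ξ)) - q) = 2 * (p + (U.dim (U.cmProd F (blkB Ξ)) - q)) := by
    omega
  have hZ0 : U.cupC (U.cmProd F Ξ) (2 * p) (2 * (U.dim (U.cmProd F (blkB Ξ)) - q)) (U.pullC pA (2 * p) x₂)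
      (U.pullC pB (2 * (U.dim (U.cmProd F (blkB Ξ)) - q)) w') ≠ 0 :=
    U.box_ne_zero M h5 h7 Ξ hP (fun h => hx0 (h0x.mpr h)) w' w₂ h6' (by rw [trC_castC, htr]; exact one_ne_zero)
  have hZw := U.isWeightVector_box' Ξ M hN1 hP (by omega) (by omega) (hwx.mp hxw) hw'
  refine ⟨⟨n + 1 + m, Ξ, p + (U.dim (U.cmProd F (blkB Ξ)) - q), (Fin.append S (fun i => (S' i)ᶜ) :), U.castC _ hdeg
      (U.cupC (U.cmProd F Ξ) (2 * p) (2 * (U.dim (U.cmProd F (blkB Ξ)) - q)) (U.pullC pA (2 * p) x₂)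
        (U.pullC pB (2 * (U.dim (U.cmProd F (blkB Ξ)) - q)) w')),
      fun h => hZ0 ((LinearEquiv.map_eq_zero_iff _).mp h), U.isWeightVector_castC F Ξ _ hdeg hZw⟩, ?_, ?_⟩
  · -- `a(Z) = a(e) - a(W)`
    show lefChar Ξ (Fin.append S (fun i => (S' i)ᶜ) :) = lefChar Θ S - lefChar Θ' S'
    rw [lefChar_append, lefChar_congr hA, lefChar_congr hB,
      eq_neg_of_add_eq_zero_right (lefChar_add_lefChar_compl Θ' S'), sub_eq_add_neg]
  · -- (v) `Z` algebraic ⇒ `e` algebraic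
    intro hZalg
    change U.castC _ hdeg (U.cupC (U.cmProd F Ξ) (2 * p) (2 * (U.dim (U.cmProd F (blkB Ξ)) - q))
      (U.pullC pA (2 * p) x₂) (U.pullC pB (2 * (U.dim (U.cmProd F (blkB Ξ)) - q)) w')) ∈
        U.algC (U.cmProd F Ξ) (p + (U.dim (U.cmProd F (blkB Ξ)) - q)) at hZalg
    show x ∈ U.algC (U.cmProd F Θ) p
    refine hax.mpr ?_
    obtain ⟨gy, hgy1, hgy2⟩ := h7 F n m Ξ pA pB hP
    have hpB : U.pullC pB (2 * q) w₂ ∈ U.algC (U.cmProd F Ξ) q := U.pullC_mem_algC M.pull_alg pB q (haw.mp hW)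
    have hdeg1 : 2 * (p + (U.dim (U.cmProd F (blkB Ξ)) - q)) + 2 * q =
        2 * (p + (U.dim (U.cmProd F (blkB Ξ)) - q) + q) := by omega
    have hA1 := U.cupC_mem_algC h4 _ (p + (U.dim (U.cmProd F (blkB Ξ)) - q)) q hZalg hpB hdeg1
    have hidx : p + (U.dim (U.cmProd F (blkB Ξ)) - q) + q = p + U.dim (U.cmProd F (blkB Ξ)) := by omega
    have hA2 := (U.castC_mem_algC_iff (U.cmProd F Ξ) hidx (by omega) _).mpr hA1
    have hA3 := gyC_mem_algC gy hgy1 p hA2 (by omega)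
    obtain ⟨ω, hω⟩ : ∃ ω, ω = U.castC _ h6' (U.cupC _ (2 * (U.dim (U.cmProd F (blkB Ξ)) - q)) (2 * q) w' w₂) :=
      ⟨_, rfl⟩
    have hωback : U.cupC _ (2 * (U.dim (U.cmProd F (blkB Ξ)) - q)) (2 * q) w' w₂ = U.castC _ h6'.symm ω := by
      rw [hω, castC_castC, castC_self]
    have htrω : U.trC _ (2 * U.dim (U.cmProd F (blkB Ξ))) ω = 1 := by
      rw [hω, trC_castC]; exact htr
    have calc1 : U.cupC (U.cmProd F Ξ) (2 * (p + (U.dim (U.cmProd F (blkB Ξ)) - q))) (2 * q) (U.castC _ hdeg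
        (U.cupC (U.cmProd F Ξ) (2 * p) (2 * (U.dim (U.cmProd F (blkB Ξ)) - q)) (U.pullC pA (2 * p) x₂)
          (U.pullC pB (2 * (U.dim (U.cmProd F (blkB Ξ)) - q)) w')))
        (U.pullC pB (2 * q) w₂) =
        U.castC _ (by omega : 2 * p + 2 * U.dim (U.cmProd F (blkB Ξ)) = 2 * (p + (U.dim (U.cmProd F (blkB Ξ)) - q)) + 2 * q)
          (U.cupC (U.cmProd F Ξ) (2 * p) (2 * U.dim (U.cmProd F (blkB Ξ))) (U.pullC pA (2 * p) x₂)
            (U.pullC pB (2 * U.dim (U.cmProd F (blkB Ξ))) ω)) := by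
      rw [cupC_castC_left, cupC_assoc U h5, ← pullC_cupC U M.pull_cup, hωback, pullC_castC, cupC_castC_right]
      simp only [castC_castC]
    have calc2 : (gy (2 * p)).baseChange ℂ
        (U.cupC (U.cmProd F Ξ) (2 * p) (2 * U.dim (U.cmProd F (blkB Ξ))) (U.pullC pA (2 * p) x₂)
          (U.pullC pB (2 * U.dim (U.cmProd F (blkB Ξ))) ω)) = x₂ := by
      rw [gyC_proj gy hgy2, htrω, one_smul]
    rw [calc1] at hA3
    simp only [castC_castC, castC_self] at hA3
    rwa [calc2] at hA3

/-! ## 10. The degree-0 residue `Qw8MilneZero` from the generic facts -/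


-- port_pkg: scope closed for this part
end Universe
end HodgeCM
end
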